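import Summits.KontsevichZagierPeriods.KontsevichZagierPeriods.Theses.ScissorsAvatars
import Summits.KontsevichZagierPeriods.KontsevichZagierPeriods.Theorems.RealOnePeriodRelations.Negative.Saturation
import Literature.NumberTheory.Transcendental.KZRelationsLE
import Literature.NumberTheory.Transcendental.KZSubcalculusInvariants

/-!
# `DivisibilityScissors` (stmt-KontsevichZagierPeriods-4262, route ScissorsAvatars) — proof

The Newton–Leibniz-free "scissors" sub-calculus `C₁₂ = closure (domainAddRel ∪ integrandAddRel ∪
changeOfVariablesRel)` of the Kontsevich–Zagier calculus has a torsion-free quotient: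
`N • c ∈ C₁₂ → c ∈ C₁₂` for every `N ≥ 1`.

Proof (the route's sketch, all ingredients in the tree):
* the scaling endomorphism `S = KZ.scale (N⁻¹)` of `KZ.FormalRep` (`[σ, f] ↦ [σ, f/N]`,
  `KZRelationsLE.lean`) maps each of the three move sets into itself
  (`KZ.scale_mem_domainAddRel`, `KZ.scale_mem_integrandAddRel`, `KZ.scale_mem_changeOfVariablesRel`),
  hence `S(C₁₂) ⊆ C₁₂` (`AddSubgroup.closure_le`);
* `c − N • S c` lies in the subgroup generated by integrand additivity alone
  (`RealOnePeriodRelationsNegative.sub_nsmul_scale_inv_mem`, built on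
  `KZ.IntegralRep.of_constMul_nat_sub_nsmul_mem`), a fortiori in `C₁₂`;
* so `N • c ∈ C₁₂` gives `N • S c = S (N • c) ∈ C₁₂` and `c = (c − N • S c) + N • S c ∈ C₁₂`.
-/

noncomputable section

open Literature.NumberTheory.Transcendental
open Summit.KontsevichZagierPeriods.SymplecticScissors.RealOnePeriodRelationsNegative
  (sub_nsmul_scale_inv_mem isAlgebraic_inv_nat)

namespace Summit.KontsevichZagierPeriods.ScissorsAvatars

/-- The scaling endomorphism `KZ.scale a ha` maps the scissors sub-calculus
`closure (domainAddRel ∪ integrandAddRel ∪ changeOfVariablesRel)` into itself (each of the three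
move sets is homogeneous under scaling the integrands). [cite: KontsevichZagier2001, §1.2] -/
theorem scale_mem_closure₁₂ (a : ℝ) (ha : IsAlgebraic ℚ a) {c : KZ.FormalRep}
    (hc : c ∈ AddSubgroup.closure
      (KZ.domainAddRel ∪ KZ.integrandAddRel ∪ KZ.changeOfVariablesRel)) :
    KZ.scale a ha c ∈ AddSubgroup.closure
      (KZ.domainAddRel ∪ KZ.integrandAddRel ∪ KZ.changeOfVariablesRel) := by
  have h : AddSubgroup.closure (KZ.domainAddRel ∪ KZ.integrandAddRel ∪ KZ.changeOfVariablesRel) ≤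
      (AddSubgroup.closure
        (KZ.domainAddRel ∪ KZ.integrandAddRel ∪ KZ.changeOfVariablesRel)).comap (KZ.scale a ha) := by
    refine (AddSubgroup.closure_le _).mpr ?_
    rintro x ((hx | hx) | hx)
    · exact AddSubgroup.subset_closure (Or.inl (Or.inl (KZ.scale_mem_domainAddRel a ha hx)))
    · exact AddSubgroup.subset_closure (Or.inl (Or.inr (KZ.scale_mem_integrandAddRel a ha hx)))
    · exact AddSubgroup.subset_closure (Or.inr (KZ.scale_mem_changeOfVariablesRel a ha hx))
  exact h hc

/-- **`DivisibilityScissors`** (route ScissorsAvatars, stmt-KontsevichZagierPeriods-4262): the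
scissors quotient is torsion-free, `0 < N → N • c ∈ C₁₂ → c ∈ C₁₂` for
`C₁₂ = closure (domainAddRel ∪ integrandAddRel ∪ changeOfVariablesRel)`:
`c = (c − N • S c) + S (N • c)` with `S = KZ.scale (N⁻¹)`, the first summand in `closure (1b)`
(`sub_nsmul_scale_inv_mem`) and the second in `C₁₂` (`scale_mem_closure₁₂`).
[cite: KontsevichZagier2001, §1.2] -/
theorem divisibilityScissors_proof :
    Summit.KontsevichZagierPeriods.KontsevichZagierPeriods.Theses.ScissorsAvatars.DivisibilityScissors := by
  intro c N hN h
  have hN' : N ≠ 0 := hN.ne'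
  have h1 : KZ.scale ((N : ℝ)⁻¹) (isAlgebraic_inv_nat N) (N • c) ∈
      AddSubgroup.closure (KZ.domainAddRel ∪ KZ.integrandAddRel ∪ KZ.changeOfVariablesRel) :=
    scale_mem_closure₁₂ _ _ h
  rw [map_nsmul] at h1
  have h2 : c - N • KZ.scale ((N : ℝ)⁻¹) (isAlgebraic_inv_nat N) c ∈
      AddSubgroup.closure (KZ.domainAddRel ∪ KZ.integrandAddRel ∪ KZ.changeOfVariablesRel) :=
    AddSubgroup.closure_mono (fun _ hx => Or.inl (Or.inr hx)) (sub_nsmul_scale_inv_mem N hN' c)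
  have h3 : c = (c - N • KZ.scale ((N : ℝ)⁻¹) (isAlgebraic_inv_nat N) c) +
      N • KZ.scale ((N : ℝ)⁻¹) (isAlgebraic_inv_nat N) c := by abel
  rw [h3]
  exact AddSubgroup.add_mem _ h2 h1

end Summit.KontsevichZagierPeriods.ScissorsAvatars

end
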